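import Summits.Ventures.Crystal3D.Theorems.StickyWulffConstantTextureLiminfLayerChart
import Summits.Ventures.Crystal3D.Theorems.StickyWulffConstantTextureLiminfTexShadowLayerFluxDefs
import Summits.Ventures.Crystal3D.Theorems.StickyWulffConstantTextureLiminfFluxCount
import HarnessLib

/-!
# In-layer site ROWS of a Barlow plate (partner direction, rows are sites) and box integrands
# (LAYER-FLUX chain piece 3a, booked cf-p1 ROUTE.md §86(72) BO; crux `TextureLiminf`, stmt-Ventures-19483)

HONEST FRAMING. Venture `Summits/Ventures/Crystal3D` (cell `crystal3d-full`), helper `--supports` the crux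
`TextureLiminf` (stmt-Ventures-19483) of `route-Ventures-StickyWulffConstant`, registered line `TexShadow`.  Rung credit
only; F-C1 not moved.  Vocabulary + elementary lemmas for the in-layer flux count (`…LayerCount`).

Objects (model coordinates of the plate `(L, s, σ)`): `w = bestLayerDir L e` (the best signed in-layer bond toward `e`,
`…LayerFluxDefs`), `w' = bestLayerPartner L e` (its 60°-partner, a lattice vector with `det[w, w'] = √3/2`), the in-layer
site rows `layerSite σ L e k i j = barlowPos σ k 0 0 + i w + j w'` (`i ∈ ℤ` along the row, rows indexed by `(k, j)`).
* `bestLayerPartner`, `axis_partner_cases`, `bestLayerPartner_apply_two`, `det_bestLayerDir_partner` (= √3/2),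
  `norm_bestLayerPartner`, `layerSite_mem` / `layerSite_mem_stacking` (rows consist of sites of layer `k`);
* `layBox`, `lintegral_le_card_boxes` (an integrand `≤ C` supported on the boxes `[j, j+1) × [0, η)`, `j ∈ J`,
  integrates to `≤ C · #J · η`).
WHAT THIS IS NOT: not the count; F-C1 not moved.
-/

noncomputable section

namespace Summit.Ventures.Crystal3D.Theorems


open MeasureTheory Set
open scoped ENNReal InnerProductSpace
open Literature.MathematicalPhysics.StatisticalMechanics (barlowPos barlowLayer triangularVec₁ triangularVec₂
  barlowPos_apply_two)
open Summit.Ventures.Crystal3D.Cruxes.TextureLiminf.TexShadow (E3 e₃ laySlab stacking layerRise bestLayerAxis bestLayerDir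
  layerFlux bestLayerAxis_spec inner_bestLayerDir norm_bestLayerDir bestLayerDir_apply_two layerRise_le_one triangularVec_coords)

/-! ## The partner direction and the site rows -/

/-- The unsigned 60°-partner of the best axis: `u ↦ v`, `v ↦ v − u`, `u − v ↦ u` (same case split as `bestLayerAxis`). -/
def bestLayerPartnerAxis (L : E3 ≃ₗᵢ[ℝ] E3) (e : E3) : E3 :=
  if |⟪triangularVec₁ 1 - triangularVec₂ 1, L.symm e⟫_ℝ| ≤
      max |⟪triangularVec₁ 1, L.symm e⟫_ℝ| |⟪triangularVec₂ 1, L.symm e⟫_ℝ| then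
    (if |⟪triangularVec₂ 1, L.symm e⟫_ℝ| ≤ |⟪triangularVec₁ 1, L.symm e⟫_ℝ| then triangularVec₂ 1
      else triangularVec₂ 1 - triangularVec₁ 1)
  else triangularVec₁ 1

/-- **The partner direction** `w'` of `w = bestLayerDir`: the partner axis with the same sign. -/
def bestLayerPartner (L : E3 ≃ₗᵢ[ℝ] E3) (e : E3) : E3 :=
  (if 0 ≤ ⟪bestLayerAxis L e, L.symm e⟫_ℝ then (1 : ℝ) else -1) • bestLayerPartnerAxis L e

/-- The three (axis, partner) cases. -/
theorem axis_partner_cases (L : E3 ≃ₗᵢ[ℝ] E3) (e : E3) :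
    (bestLayerAxis L e = triangularVec₁ 1 ∧ bestLayerPartnerAxis L e = triangularVec₂ 1) ∨
    (bestLayerAxis L e = triangularVec₂ 1 ∧ bestLayerPartnerAxis L e = triangularVec₂ 1 - triangularVec₁ 1) ∨
    (bestLayerAxis L e = triangularVec₁ 1 - triangularVec₂ 1 ∧ bestLayerPartnerAxis L e = triangularVec₁ 1) := by
  unfold bestLayerAxis bestLayerPartnerAxis
  split_ifs
  · exact Or.inl ⟨rfl, rfl⟩
  · exact Or.inr (Or.inl ⟨rfl, rfl⟩)
  · exact Or.inr (Or.inr ⟨rfl, rfl⟩)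

/-- The sign of the best direction. -/
def layerSign (L : E3 ≃ₗᵢ[ℝ] E3) (e : E3) : ℝ := if 0 ≤ ⟪bestLayerAxis L e, L.symm e⟫_ℝ then (1 : ℝ) else -1

/-- The sign is `±1`. -/
theorem layerSign_cases (L : E3 ≃ₗᵢ[ℝ] E3) (e : E3) : layerSign L e = 1 ∨ layerSign L e = -1 := by
  unfold layerSign; split_ifs
  · exact Or.inl rfl
  · exact Or.inr rfl

/-- `w = sign • axis`, `w' = sign • partnerAxis`. -/
theorem bestLayerDir_eq (L : E3 ≃ₗᵢ[ℝ] E3) (e : E3) :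
    bestLayerDir L e = layerSign L e • bestLayerAxis L e ∧ bestLayerPartner L e = layerSign L e • bestLayerPartnerAxis L e :=
  ⟨rfl, rfl⟩

/-- Coordinates of `w` and `w'` in the three cases: `(w₀, w₁, w'₀, w'₁) = sign · (1, 0, ½, √3/2)`, `sign · (½, √3/2, −½, √3/2)`,
`sign · (½, −√3/2, 1, 0)`; both are horizontal. -/
theorem bestLayer_coords (L : E3 ≃ₗᵢ[ℝ] E3) (e : E3) :
    bestLayerPartner L e 2 = 0 ∧
    bestLayerDir L e 0 * bestLayerPartner L e 1 - bestLayerDir L e 1 * bestLayerPartner L e 0 = Real.sqrt 3 / 2 := by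
  obtain ⟨h10, h11, h12, h20, h21, h22⟩ := triangularVec_coords
  obtain ⟨hw, hw'⟩ := bestLayerDir_eq L e
  have hs3 : Real.sqrt 3 * Real.sqrt 3 = 3 := Real.mul_self_sqrt (by norm_num)
  rw [hw, hw']
  simp only [PiLp.smul_apply, smul_eq_mul]
  rcases layerSign_cases L e with hs | hs <;> rw [hs] <;>
    rcases axis_partner_cases L e with ⟨ha, hp⟩ | ⟨ha, hp⟩ | ⟨ha, hp⟩ <;> rw [ha, hp] <;>
    simp only [PiLp.sub_apply, h10, h11, h12, h20, h21, h22] <;> constructor <;> ring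

/-- The partner is horizontal. -/
theorem bestLayerPartner_apply_two (L : E3 ≃ₗᵢ[ℝ] E3) (e : E3) : bestLayerPartner L e 2 = 0 := (bestLayer_coords L e).1

/-- **`det[w, w'] = √3/2`.** -/
theorem det_bestLayerDir_partner (L : E3 ≃ₗᵢ[ℝ] E3) (e : E3) :
    bestLayerDir L e 0 * bestLayerPartner L e 1 - bestLayerDir L e 1 * bestLayerPartner L e 0 = Real.sqrt 3 / 2 :=
  (bestLayer_coords L e).2

/-- The partner is a unit vector. -/
theorem norm_bestLayerPartner (L : E3 ≃ₗᵢ[ℝ] E3) (e : E3) : ‖bestLayerPartner L e‖ = 1 := by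
  obtain ⟨n1, n2, n3⟩ := Summit.Ventures.Crystal3D.Cruxes.TextureLiminf.TexShadow.norm_layerAxes
  have n3' : ‖(triangularVec₂ 1 : E3) - triangularVec₁ 1‖ = 1 := by rw [← norm_neg, neg_sub, n3]
  have hn : ‖bestLayerPartnerAxis L e‖ = 1 := by
    rcases axis_partner_cases L e with ⟨-, hp⟩ | ⟨-, hp⟩ | ⟨-, hp⟩ <;> rw [hp] <;> assumption
  rw [(bestLayerDir_eq L e).2, norm_smul, hn, mul_one]
  rcases layerSign_cases L e with h | h <;> rw [h] <;> simp

/-- **The in-layer site row `(k, j)`**: `i ↦ barlowPos σ k 0 0 + i w + j w'`. -/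
def layerSite (σ : ℤ → ℤ) (L : E3 ≃ₗᵢ[ℝ] E3) (e : E3) (k i j : ℤ) : E3 :=
  barlowPos 1 (Real.sqrt (2 / 3)) σ k 0 0 + (i : ℝ) • bestLayerDir L e + (j : ℝ) • bestLayerPartner L e

/-- A layer is a lattice translate: `barlowPos σ k m n = barlowPos σ k 0 0 + m u + n v`. -/
theorem barlowPos_eq_base_add (σ : ℤ → ℤ) (k m n : ℤ) :
    barlowPos 1 (Real.sqrt (2 / 3)) σ k m n =
      barlowPos 1 (Real.sqrt (2 / 3)) σ k 0 0 + (m : ℝ) • triangularVec₁ 1 + (n : ℝ) • triangularVec₂ 1 := by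
  simp only [barlowPos]
  push_cast
  module

/-- **The rows consist of sites of layer `k`.** -/
theorem layerSite_mem (σ : ℤ → ℤ) (L : E3 ≃ₗᵢ[ℝ] E3) (e : E3) (k i j : ℤ) :
    layerSite σ L e k i j ∈ barlowLayer 1 (Real.sqrt (2 / 3)) σ k := by
  obtain ⟨hw, hw'⟩ := bestLayerDir_eq L e
  unfold layerSite
  rw [hw, hw']
  -- integer sign
  obtain ⟨sg, hsg, hsgeq⟩ : ∃ sg : ℤ, (sg = 1 ∨ sg = -1) ∧ layerSign L e = (sg : ℝ) := by
    rcases layerSign_cases L e with h | h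
    · exact ⟨1, Or.inl rfl, by rw [h]; norm_num⟩
    · exact ⟨-1, Or.inr rfl, by rw [h]; norm_num⟩
  rw [hsgeq]
  rcases axis_partner_cases L e with ⟨ha, hp⟩ | ⟨ha, hp⟩ | ⟨ha, hp⟩ <;> rw [ha, hp]
  · refine ⟨sg * i, sg * j, ?_⟩
    rw [barlowPos_eq_base_add σ k (sg * i) (sg * j)]; push_cast; module
  · refine ⟨-(sg * j), sg * i + sg * j, ?_⟩
    rw [barlowPos_eq_base_add σ k (-(sg * j)) (sg * i + sg * j)]; push_cast; module
  · refine ⟨sg * i + sg * j, -(sg * i), ?_⟩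
    rw [barlowPos_eq_base_add σ k (sg * i + sg * j) (-(sg * i))]; push_cast; module

/-- In the cell: `L (layerSite … k i j) + s ∈ stacking L s σ`. -/
theorem layerSite_mem_stacking (σ : ℤ → ℤ) (L : E3 ≃ₗᵢ[ℝ] E3) (e s : E3) (k i j : ℤ) :
    L (layerSite σ L e k i j) + s ∈ stacking L s σ := by
  obtain ⟨x, y, h⟩ := layerSite_mem σ L e k i j
  exact ⟨_, ⟨k, x, y, h⟩, rfl⟩

/-! ## Integrands supported on boxes -/

/-- The box `[j, j+1) × [0, η)`. -/
def layBox (η : ℝ) (j : ℤ) : Set (Fin 2 → ℝ) :=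
  Set.pi Set.univ fun i => Ico (if i = 0 then (j : ℝ) else 0) (if i = 0 then (j : ℝ) + 1 else η)

/-- Its volume is `ofReal η`. -/
theorem volume_layBox (η : ℝ) (j : ℤ) : volume (layBox η j) = ENNReal.ofReal η := by
  rw [layBox, Real.volume_pi_Ico, Fin.prod_univ_two]
  simp

/-- The boxes are measurable. -/
theorem measurableSet_layBox (η : ℝ) (j : ℤ) : MeasurableSet (layBox η j) :=
  MeasurableSet.univ_pi fun _ => measurableSet_Ico

/-- Box membership from the coordinates. -/
theorem mem_layBox {η : ℝ} (x : Fin 2 → ℝ) (h0 : 0 ≤ x 1) (h1 : x 1 < η) : x ∈ layBox η ⌊x 0⌋ := by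
  simp only [layBox, Set.mem_pi, Set.mem_univ, Set.mem_Ico, forall_true_left]
  intro i
  fin_cases i
  · exact ⟨Int.floor_le _, Int.lt_floor_add_one _⟩
  · exact ⟨h0, h1⟩

/-- **An integrand `≤ C` supported on the boxes of a finite set `J` integrates to at most `C · #J · η`.** -/
theorem lintegral_le_card_boxes (G : (Fin 2 → ℝ) → ℝ≥0∞) (C : ℝ≥0∞) (η : ℝ) (J : Finset ℤ)
    (hGC : ∀ x, G x ≤ C) (hG0 : ∀ x, G x ≠ 0 → 0 ≤ x 1 ∧ x 1 < η ∧ ⌊x 0⌋ ∈ J) :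
    ∫⁻ x, G x ≤ C * (J.card : ℝ≥0∞) * ENNReal.ofReal η := by
  classical
  set U : Set (Fin 2 → ℝ) := ⋃ j ∈ J, layBox η j with hU
  have hUmeas : MeasurableSet U := MeasurableSet.biUnion J.countable_toSet fun j _ => measurableSet_layBox η j
  have hle : ∀ x, G x ≤ U.indicator (fun _ => C) x := by
    intro x
    by_cases hx : G x = 0
    · rw [hx]; exact zero_le
    · obtain ⟨h0, h1, hj⟩ := hG0 x hx
      have hmem : x ∈ U := by
        rw [hU, Set.mem_iUnion₂]
        exact ⟨_, hj, mem_layBox x h0 h1⟩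
      rw [Set.indicator_of_mem hmem]
      exact hGC x
  calc ∫⁻ x, G x ≤ ∫⁻ x, U.indicator (fun _ => C) x := lintegral_mono hle
    _ = C * volume U := lintegral_indicator_const hUmeas C
    _ ≤ C * ∑ j ∈ J, volume (layBox η j) := by gcongr; exact measure_biUnion_finset_le J (layBox η)
    _ = C * (J.card : ℝ≥0∞) * ENNReal.ofReal η := by
        simp only [volume_layBox, Finset.sum_const, nsmul_eq_mul]; ring


end Summit.Ventures.Crystal3D.Theorems

end
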